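import Literature.NumberTheory.Automorphic.Liu2021.Sec52ArithmeticInvariantFunctionals
import Literature.NumberTheory.Automorphic.Liu2021.Sec13to16IntroductionAFL
import Mathlib.AlgebraicGeometry.Morphisms.Finite
import Mathlib.AlgebraicGeometry.Morphisms.FormallyUnramified
import Mathlib.Analysis.Calculus.Deriv.Basic
import Mathlib.FieldTheory.IsAlgClosed.AlgebraicClosure
import Mathlib.LinearAlgebra.Matrix.Charpoly.Basic
import HarnessLib

/-!
# Liu 2021, §5.3 «Orbital decomposition of local arithmetic invariant functionals» (print pp. 80–90, items 5.20–5.29) — SECTION CARPET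
# (statement-exact typing over in-file hypothesis structures; no proof)

[Liu2021] = Yifeng Liu, *Fourier–Jacobi cycles and arithmetic relative trace formula* (with an appendix by Chao Li and Yihang Zhu),
Cambridge J. Math. **9** (2021), no. 1, 1–147 = arXiv:2102.11518.  SOURCE READ: the print text held as
`paper:liu2021-fourier-jacobi-cycles-arithmetic-relative-trace-formula` (page file `pNNNN` = journal page `N`; «p. N Lk» = line `k` of that page
file).  **§5.3 opens p. 80 L100 and ends p. 90 L13** (before Appendix A).  Companion of `Sec52ArithmeticInvariantFunctionals` (§5.2; its
`Sec52IntData V τ' S 𝔭` = the datum `(X_K, K, f, φ, …)` at a good inert prime, which this file extends); same Discipline, READING L and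
READING FS (module docstring there).  THE §5.3 DATUM IS TYPED OVER the tree's App. C §C.4 carpet
`AppendixC.SecC4IntegralModelsUniformization` (TL-t06): `Sec53Data (U : UniformizationData F E) extends Sec52IntData F E U.V U.τ' U.S U.𝔭`, so that
`V`, `τ'`, the Shimura system (Rem. C.2), `𝔭`, `𝔭̲ = inertSet`, `Spl_p = splitSet`, the self-dual frames `Λ_𝔮` / stabilisers (Def. 5.16), the canonical
integral model (Def. C.21, `CanonicalIntegralModel`), the supersingular locus (Def. C.24, `U.IsSupersingular`), the frame point `P` ((C.8)–(C.10)),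
the Rapoport–Zink space `𝒩 = U.N`, `V̄ = U.Vbar` (REAL `HermSpace`), `Λ̄_𝔮`, `K̄_𝔮 = U.Kbar`, `ι_P = U.iotaGrp` and `U(V)(𝔸_F^{∞,S}) = awayFrom` are the
tree's declarations, not re-posited here.  ED.2 (squad QA-9/QA-10): the LOCAL data of §1.3 at the places `𝔮 ∈ 𝔭̲` are the tree's
★ `Sec13to16IntroductionAFL.Sec13Data` (TL-t02), carried as `Sec53Data.loc13 𝔮` over `E_𝔮/F_𝔮` — so `χ(𝒪_{Γ_ξ̄} ⊗^𝕃 𝒪_{ΔZ(x̄)})` (`chiN`), the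
orbital integrals `Orb(s; 𝟙, 𝟙; ζ, y)` (`OrbGL`), `ω_𝔮` (`omegaAt`) and the two hypotheses of Cor. 5.28 (`RFL` = the body of ★ `Stmt19_2`, `AFL` = the body
of ★ `Item112AsPrinted`, at the local image of the orbit) are DEFINED from ★, not posited; the generic `S_n` / Def. 5.27 block carries BRIDGE notes to ★.  Opening sentences (p. 80 L102 – p. 81 L6): «To further study the intersection number in Proposition 5.19,
we need a certain moduli interpretation of the integral model `𝒳_K` and `𝒵(φ)_K`. We will follow the discussion and notation in Subsection C.4.
In particular, we denote by `Spl_p` the set of primes of `F` above `p` that are split in `E`.»  Dedup (2026-09-02): green field (no tree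
declaration cites 5.20–5.29); squad TL «GO 500», deal TL-t13.

READING Q (index sets): the printed index sets `U(V)(F)\V(E)^+` (p. 72; Cor. 5.23) and `U(V_x)(𝔸_F^{∞,p})\U(V)(𝔸_F^{∞,p})/K^p` (Cor. 5.23), and
the index set of Prop. 5.22 (2), are carried as types with representative maps into the REAL ambient sets (`V(E) = E^{⊕n}`,
`U(V)(𝔸_F^{∞,p}) ≤ U(V)(𝔸_F^∞)`); sums over them are `finsum`s (the printed sums have finitely many nonzero terms for each index `T`).
Sums over the regular semisimple orbits `[U(V̄)(F) × V̄(E)]_{rs}` (REAL, `relOrbitsRS`) are evaluated at an arbitrary system of representatives.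

## INDEX (item ↦ declaration; namespace `Literature.NumberTheory.Automorphic.Liu2021.Sec53OrbitalDecomposition`)

`S_n` (p. 88 L70–71, p. 10) ↦ `symmSpace`; `M_n` (p. 21) ↦ `MnPts`; **Def. 5.27** (p. 89) ↦ `momentMatrix`, `IsGLRegularSemisimple` (1), `glAct`, `glOrbit`,
`glOrbits`, `glOrbitsRS` (2), `transferFactor`, `glOrbitsRSSign` (3) — REAL generic, BRIDGE notes to ★ `Sec13Data` — and `Matches` (4), `Sec53Data.omegaAt`
(over ★ `loc13`); **Def. 5.20**
(p. 81) ↦ structure `Frame U` (over `UniformizationData`); (5.10) and the moduli description p. 81 ↦ quoted on the carriers of `Sec53Data`; **Def. 5.21**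
(p. 81–82) ↦ carriers `Znr`, `sMor` (printed definition quoted); **Prop. 5.22** (p. 82) ↦ `Prop522_1`, `Prop522_2`, `Prop522_3`; p. 84 L37–43 ↦ carrier
`Zxg`; **Cor. 5.23** (p. 84) ↦ `Cor523`; **Lem. 5.24** (p. 85) ↦ `Lem524`; the supersingular locus `𝒳^{ss}_K` (p. 85 L36–49) ↦ `IsSupersingularPt` (REAL
over (5.10) on `k`-points and the tree's Def. C.24); (5.11) and `χ(𝒪_{Γ_ξ̄} ⊗^𝕃 𝒪_{ΔZ(x̄)})` (p. 85–86) ↦ `chiN` (★ `Sec13Data.chiInt` via `loc13`, `toLocU`/`toLocV`), carrier `IsChiFinite`;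
`V̄` (p. 86) ↦ the tree's REAL `U.Vbar`; **Thm. 5.25** (p. 86) ↦ `Thm525` (orbital integral = carrier `Orb`, printed definition quoted; orbits =
`rsOrbitsBar U`, REAL; `chiN` over ★ `loc13`); **Rem. 5.26** (p. 88) ↦
`Rem526Notion`, `Rem526Decomposition`; **Cor. 5.28** (p. 89) ↦ `Cor528` (hypotheses `RFL`, `AFL`, integrals `OrbGL` over ★ `loc13`, ED.2); **Rem. 5.29** (p. 90: expectations about split places and the choice of
test functions on the general linear side) ↦ NO declaration (not a result).  NOT typed: proofs; the sentence «We believe that a more general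
notion of good inert prime, for which a result similar to Theorem 5.25 holds, should …» of Rem. 5.26 beyond the notion itself; footnotes 13–16
(quoted where relevant); the intrinsic-ness of `𝒳^{ss}_K` (footnote 14).

## References
* [Liu2021] §5.3, pp. 80–90 (Def. 5.20, (5.10), Def. 5.21 p. 81; Prop. 5.22 p. 82; Cor. 5.23 p. 84; Lem. 5.24, (5.11) p. 85; Thm. 5.25
  p. 86; Rem. 5.26, `S_n` p. 88; Def. 5.27, Cor. 5.28 p. 89; Rem. 5.29 p. 90); §1.3 pp. 11–15 (statements 1.9, 1.12, Rem. 1.10, 1.13, 1.14;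
  `Orb(s; f, φ; ζ, y)`); §1.7 p. 21 (`M_n`); App. C §C.4 (Def. C.21, Rem. C.22, Def. C.24, Lem. C.25, Prop. C.26, (C.8), (C.11), (C.13)).
* [Liu14] Y. Liu, *Relative trace formulae toward Bessel and Fourier–Jacobi periods on unitary groups* (Def. 5.27 is «[Liu14, Section 5.3]»);
  [KR11], [How15], [Wed99], [KR14], [Cho] — the sources the proofs name (not used here).
-/

noncomputable section

open CategoryTheory
open scoped TensorProduct Matrix
open NumberField IsDedekindDomain
open Literature.NumberTheory.Automorphic.Liu2021.AppendixC (conj HermSpace)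
open Literature.NumberTheory.Automorphic.Liu2021.AppendixC.SecC4IntegralModelsUniformization
  (IsInert residueChar inertSet splitSet localGroup IsSelfDualFrame latticeStabilizer awayFrom UniformizationData
    CanonicalIntegralModel)
open Literature.NumberTheory.Automorphic.Liu2021.Sec52Defs
open Literature.NumberTheory.Automorphic.Liu2021.Sec52ArithmeticInvariantFunctionals
open Literature.NumberTheory.Automorphic.Liu2021.Sec13to16IntroductionAFL (Sec13Data)

namespace Literature.NumberTheory.Automorphic.Liu2021.Sec53OrbitalDecomposition

/-! ## Definition 5.27 and the symmetric space `S_n` (p. 88–89) — REAL, generic linear algebra -/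

section GLside

variable {R₀ R : Type} [CommRing R₀] [CommRing R] [Algebra R₀ R] {n : ℕ}

/-- **`S_n`** (p. 88 L70–71; also p. 10 L35–36): «denote by `S_n` the `𝒪_F`-subscheme of `Res_{𝒪_E/𝒪_F} Mat_{n,n}` consisting of matrices `g`
satisfying `g · g^c = I_n`» — its points in an algebra `R` on which the conjugation acts by `c : R →+* R` (`R = E' = E ⊗_F F'`, `c = c ⊗ 1`):
`{g ∈ Mat_n(R) | g · g^c = 1}`.  BRIDGE (ED.2, squad QA-9): for the local datum of §1.3 this is ★ `Sec13to16IntroductionAFL.Sec13Data.Sn` (TL-t02;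
same formula with `R = E_𝔮`, `c = D.conj`); the generic version here serves Def. 5.27, which needs both `F' = F` (Cor. 5.28's global matching orbit)
and `F' = F_v`. REAL. [cite: Liu2021, §5.3 (p. 88)] -/
def symmSpace (c : R →+* R) : Set (Matrix (Fin n) (Fin n) R) := {g | g * g.map c = 1}

/-- `M_n := Mat_{n,1} × Mat_{1,n}` (p. 21 L40; p. 89 L9: «we write `y = (y_1, y_2)` for `y_1 ∈ Mat_{n,1}(F')` and `y_2 ∈ Mat_{1,n}(F')`»): a pair of
a column and a row vector with entries in `R₀` (`= F'`) (BRIDGE: ★ `Sec13Data.Mn` for the local datum). REAL. [cite: Liu2021, §1.7 (p. 21)] -/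
abbrev MnPts (R₀ : Type) (n : ℕ) : Type := (Fin n → R₀) × (Fin n → R₀)

/-- The matrix `(y_2 ζ^{i+j−2} y_1)_{i,j=1}^n ∈ Mat_n(E')` of Def. 5.27 (1) (indices from `0`: entry `(i, j)` is `y_2 ζ^{i+j} y_1`), `y_1, y_2` read
in `R = E'` through `R₀ = F' → E'`. REAL. [cite: Liu2021, Def. 5.27 (1) (p. 89)] -/
def momentMatrix (ζ : Matrix (Fin n) (Fin n) R) (y : MnPts R₀ n) : Matrix (Fin n) (Fin n) R :=
  Matrix.of fun i j : Fin n =>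
    (fun k => algebraMap R₀ R (y.2 k)) ⬝ᵥ ((ζ ^ ((i : ℕ) + (j : ℕ))) *ᵥ fun k => algebraMap R₀ R (y.1 k))

/-- **[Liu2021, Definition 5.27 (1)]** (p. 89 L5–9): «Consider a field extension `F'/F` and put `E' := E ⊗_F F'`. (1) We say that a pair of elements
`(ζ, y) ∈ S_n(F') × M_n(F')` is *regular semisimple* if the matrix `(y_2 ζ^{i+j−2} y_1)_{i,j=1}^n` is invertible in `E'`, where we write
`y = (y_1, y_2)` for `y_1 ∈ Mat_{n,1}(F')` and `y_2 ∈ Mat_{1,n}(F')`» — invertible = its determinant is a unit of `E'` (BRIDGE, ED.2: ★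
`Sec13Data.IsRS` of the local datum is «`det ≠ 0`», the same condition when `E'` is a field). REAL. [cite: Liu2021, Def. 5.27 (1) (p. 89)] -/
def IsGLRegularSemisimple (ζ : Matrix (Fin n) (Fin n) R) (y : MnPts R₀ n) : Prop := IsUnit (momentMatrix ζ y).det

/-- **[Liu2021, Definition 5.27 (2)], the action** (p. 89 L10–11): «The group `GL_n(F')` acts on `S_n(F') × M_n(F')` via the formula
`(ζ, y_1, y_2).g = (g^{−1} ζ g, g^{−1} y_1, y_2 g)`.» (BRIDGE: ★ `Sec13Data.act` for the local datum.) REAL. [cite: Liu2021, Def. 5.27 (2) (p. 89)] -/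
def glAct (g : GL (Fin n) R₀) (p : Matrix (Fin n) (Fin n) R × MnPts R₀ n) : Matrix (Fin n) (Fin n) R × MnPts R₀ n :=
  ((((g⁻¹ : GL (Fin n) R₀) : Matrix (Fin n) (Fin n) R₀).map (algebraMap R₀ R)) * p.1 *
      ((g : Matrix (Fin n) (Fin n) R₀).map (algebraMap R₀ R)),
    (((g⁻¹ : GL (Fin n) R₀) : Matrix (Fin n) (Fin n) R₀) *ᵥ p.2.1, Matrix.vecMul p.2.2 (g : Matrix (Fin n) (Fin n) R₀)))

variable (c : R →+* R)

/-- The `GL_n(F')`-orbit of `(ζ, y) ∈ S_n(F') × M_n(F')` (Def. 5.27 (2)). REAL. [cite: Liu2021, Def. 5.27 (2) (p. 89)] -/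
def glOrbit (p : symmSpace (n := n) c × MnPts R₀ n) : Set (symmSpace (n := n) c × MnPts R₀ n) :=
  {p' | ∃ g : GL (Fin n) R₀, glAct g ((p.1 : Matrix (Fin n) (Fin n) R), p.2) = ((p'.1 : Matrix (Fin n) (Fin n) R), p'.2)}

/-- **[Liu2021, Definition 5.27 (2)]**: «Denote by `[S_n(F') × M_n(F')]` the orbits of `S_n(F') × M_n(F')` under the above action, and by
`[S_n(F') × M_n(F')]_{rs}` the subset of regular semisimple orbits» — the set of orbits. REAL. [cite: Liu2021, Def. 5.27 (2) (p. 89)] -/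
def glOrbits : Set (Set (symmSpace (n := n) c × MnPts R₀ n)) := Set.range (glOrbit (R₀ := R₀) c)

/-- **[Liu2021, Definition 5.27 (2)]**: `[S_n(F') × M_n(F')]_{rs}`, the regular semisimple orbits. REAL. [cite: Liu2021, Def. 5.27 (2) (p. 89)] -/
def glOrbitsRS : Set (Set (symmSpace (n := n) c × MnPts R₀ n)) :=
  {O ∈ glOrbits (R₀ := R₀) c | ∀ p ∈ O, IsGLRegularSemisimple (p.1 : Matrix (Fin n) (Fin n) R) p.2}

/-- **[Liu2021, Definition 5.27 (3)], the local transfer factor** (p. 89 L14–16): «Suppose that `F' = F_v` for some place `v` of `F`. For a regular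
semisimple pair `(ζ, y) ∈ S_n(F') × M_n(F')`, we define its *local transfer factor* to be `ω_v(ζ, y) := μ_{E/F}(det(y_1, ζ y_1, …, ζ^{n−1} y_1))`.»
Typed with the character `μ` (the printed `μ_{E/F}` as evaluated on this determinant in `E'`) as a parameter (BRIDGE, ED.2: ★ `Sec13Data.transferFactor`
of the local datum is this formula with `μ = Sec13Data.muEF`; §5.3 below uses the ★ one through `Sec53Data.loc13`, see `Sec53Data.omegaAt`). REAL.
[cite: Liu2021, Def. 5.27 (3) (p. 89)] -/
def transferFactor (μ : R → ℂ) (ζ : Matrix (Fin n) (Fin n) R) (y : MnPts R₀ n) : ℂ :=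
  μ (Matrix.of fun i j : Fin n => ((ζ ^ (j : ℕ)) *ᵥ fun k => algebraMap R₀ R (y.1 k)) i).det

/-- **[Liu2021, Definition 5.27 (3)], the signed parts** (p. 89 L16–21): «We denote by `[S_n(F') × M_n(F')]^±_{rs}` the subset of `[S_n(F') × M_n(F')]_{rs}`
of orbits `(ζ, y)` such that `μ_{E/F}(det(y_2 ζ^{i+j−2} y_1)_{i,j=1}^n) = ±1`» (sign `ε = 1` or `ε = −1`; evaluated at the members of the orbit —
the printed expression is an orbit invariant). REAL. [cite: Liu2021, Def. 5.27 (3) (p. 89)] -/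
def glOrbitsRSSign (μ : R → ℂ) (ε : ℂ) : Set (Set (symmSpace (n := n) c × MnPts R₀ n)) :=
  {O ∈ glOrbitsRS (R₀ := R₀) c | ∀ p ∈ O, μ (momentMatrix (p.1 : Matrix (Fin n) (Fin n) R) p.2).det = ε}

end GLside

/-! ## §5.3 Orbital decomposition of local arithmetic invariant functionals (pp. 80–90): the datum and the statements -/

section Sec53

variable (F E : Type) [Field F] [NumberField F] [IsTotallyReal F] [Field E] [NumberField E] [Algebra F E]
  [IsTotallyComplex E] [Algebra.IsQuadraticExtension F E]

/-- **[Liu2021, Definition 5.20] (a frame)** (p. 81 L7–27): «A *frame* for the (good inert) prime `𝔭` (with the underlying rational prime `p`)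
contains the following • an isomorphism between the two `E`-extensions `ℂ` and `E_𝔭^{ac}`, • a CM type `Φ` of `E` containing the fixed embedding
`τ'`, such that elements in `Φ` inducing the same prime in `Spl_p` induce the same prime of `E` (under the above isomorphism between `ℂ` and
`E_𝔭^{ac}`), • a rational skew-hermitian space `W_0^∞` over `𝔸_E^∞` of rank `1` such that `W(W_0^∞, Φ^c)` is nonempty and that `W_0^∞ ⊗_{𝔸^∞} ℚ_p`
admits a self-dual lattice, • a sufficiently small open compact subgroup `L_0 = L_0^p × (L_0)_p` of `H_0^∞(𝔸^∞)` in which `(L_0)_p` is the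
stabilizer of a self-dual lattice in `W_0^∞ ⊗_{𝔸^∞} ℚ_p`, where `H_0^∞` is the group of similitude of `W_0^∞`, • a point
`P : Spec 𝒪_{E_𝔭^{nr}} → 𝓜(V, W_0^∞, Φ)_{K_p,L_0}` as in (C.8), whose reduction is in the supersingular locus, where `E_𝔭^{nr}` is the maximal
unramified extension of `E_𝔭` contained in `E_𝔭^{ac}`.»  Here «`Spl_p` the set of primes of `F` above `p` that are split in `E`» (p. 81 L5–6) =
the tree's `splitSet E 𝔭`.  Typed OVER the tree's datum `U : UniformizationData` of App. C §C.4 (`SecC4IntegralModelsUniformization`), which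
already carries the point `P` — (C.8) `ℙ`, its reduction `U.Pk` with `U.Pk_supersingular` («whose reduction is in the supersingular locus»), the
sections (C.9) `U.P`, (C.10) `U.Ploc` — and the place `U.𝔓` of `E` over `𝔭` (`E_𝔭` = the `U.𝔓`-adic completion); so the frame ADDS: REAL the
ring isomorphism `ℂ ≃ (E_𝔭)^{ac}` compatible with `τ'` and `E → E_𝔭 → (E_𝔭)^{ac}` (Mathlib `AlgebraicClosure`), the CM type `Φ ∋ τ'` (tree
`CMType`) and its compatibility condition stated through the ⟨CARRIER⟩ `primeOf` («the prime of `E` induced by an embedding `E → ℂ ≅ E_𝔭^{ac}`»);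
⟨CARRIER⟩ `W_0^∞`, `H_0^∞(𝔸^∞)`, `L_0` with their printed side conditions recorded in the field docstrings (Def. C.10–C.12; squad file
`AppendixC/SecC2Similitude` (TL-t04)).  A datum; nothing is asserted. [cite: Liu2021, Def. 5.20 (p. 81)] -/
structure Frame (U : UniformizationData F E) : Type 1 where
  /-- «an isomorphism between the two `E`-extensions `ℂ` and `E_𝔭^{ac}`» (p. 81 L9): a ring isomorphism `ℂ ≃ (E_𝔭)^{ac}`, `E_𝔭 = E_𝔓`,
  `𝔓 = U.𝔓` the prime of `E` over the inert `𝔭`. REAL type. -/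
  iso : ℂ ≃+* AlgebraicClosure (U.𝔓.1.adicCompletion E)
  /-- … of `E`-extensions: compatible with `τ' : E → ℂ` and `E → E_𝔭 → (E_𝔭)^{ac}`. REAL. -/
  iso_comp : ∀ e : E, iso (U.τ' e) =
    algebraMap (U.𝔓.1.adicCompletion E) (AlgebraicClosure (U.𝔓.1.adicCompletion E)) (algebraMap E (U.𝔓.1.adicCompletion E) e)
  /-- «a CM type `Φ` of `E`» (tree `CMType`). REAL. -/
  Φ : Literature.AlgebraicGeometry.Motives.CMType E
  /-- «containing the fixed embedding `τ'`». REAL. -/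
  τ'_mem : U.τ' ∈ Φ.1
  /-- ⟨CARRIER⟩ the prime of `E` (above `p`) induced by a complex embedding of `E` «under the above isomorphism between `ℂ` and `E_𝔭^{ac}`»
  (p. 81 L10–11: pull back the `p`-adic valuation of `E_𝔭^{ac}` along `E → ℂ ≅ E_𝔭^{ac}`). -/
  primeOf : (E →+* ℂ) → HeightOneSpectrum (𝓞 E)
  /-- «elements in `Φ` inducing the same prime in `Spl_p` induce the same prime of `E`» (p. 81 L10–11). REAL over `primeOf` and the tree's
  `splitSet`. -/
  Φ_compat : ∀ φ₁ ∈ Φ.1, ∀ φ₂ ∈ Φ.1, (primeOf φ₁).under (𝓞 F) = (primeOf φ₂).under (𝓞 F) →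
    (primeOf φ₁).under (𝓞 F) ∈ splitSet E U.𝔭 → primeOf φ₁ = primeOf φ₂
  /-- ⟨CARRIER⟩ «a rational skew-hermitian space `W_0^∞` over `𝔸_E^∞` of rank `1` such that `W(W_0^∞, Φ^c)` is nonempty and that `W_0^∞ ⊗_{𝔸^∞} ℚ_p`
  admits a self-dual lattice» (p. 81 L12–15; Def. C.10–C.12). -/
  W0 : Type
  /-- ⟨CARRIER⟩ «`H_0^∞` … the group of similitude of `W_0^∞`», its `𝔸^∞`-points `H_0^∞(𝔸^∞)` as a (bundled) group (p. 81 L17–23). -/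
  H0 : GrpCat.{0}
  /-- ⟨CARRIER⟩ «a sufficiently small open compact subgroup `L_0 = L_0^p × (L_0)_p` of `H_0^∞(𝔸^∞)` in which `(L_0)_p` is the stabilizer of a
  self-dual lattice in `W_0^∞ ⊗_{𝔸^∞} ℚ_p`» (p. 81 L17–20). -/
  L0 : Subgroup H0

/-- **Data of [Liu2021, §5.3]** (pp. 80–90): «Now we take a frame. Put `k := 𝒪_{E_𝔭^{nr}} ⊗_ℤ 𝔽_p` [sic; the residue field] and
`𝒳^{nr}_K := 𝒳_K ⊗_{𝒪_{E_𝔭}} 𝒪_{E_𝔭^{nr}}`» (p. 81 L28–31), the Cartesian diagram (5.10) «`𝒳^{nr}_K → 𝓜(V, W_0^∞, Φ)^{nr}_{K,L_0}` over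
`Spec 𝒪_{E_𝔭^{nr}} —q_0∘P→ 𝓜(W_0^∞, Φ^c)_{L_0} ⊗ 𝒪_{E_𝔭^{nr}}`» and the nonuple moduli description of `𝒳^{nr}_K(S)` (p. 81 L32–53), the relative
functors `s_{x,g^p} : Z(x, g^p)^{nr}_K → 𝒳^{nr}_K` of Def. 5.21, the supersingular locus and its uniformization (5.11)
«`𝒳^{ss,∧}_K ≃ U(V̄)(F)\[𝒩 × U(V̄)(𝔸_F^{∞,p})/K̄^p]`» (p. 85 L36 – p. 86 L5), the orbital integral of Theorem 5.25 (p. 86 L34–74) and, for Cor. 5.28,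
the orbital integrals `Orb(s; 𝟙_{S_n(𝒪_{F_𝔮})}, 𝟙_{M_n(𝒪_{F_𝔮})}; ζ, y)` of §1.3 (p. 12 L26–35) and the character `μ_{E/F}` (§1.7).  THE DATUM IS
TYPED OVER the tree's `U : UniformizationData F E` of App. C §C.4 (`SecC4IntegralModelsUniformization`, TL-t06), whose REAL/carrier fields
ARE the objects §5.3 takes from App. C: `U.V`, `U.τ'`, `U.S` (Rem. C.2), `U.𝔭`, `U.𝔓`, the frames `U.Λ` / stabilisers `U.Kat` (Def. 5.16 =
l. 4912–4917), the `k`-points `U.kPts` of `𝓜(V, W_0^∞, Φ)^{nr}_{K_𝔭̲,L_0}` with Def. C.24 `U.IsSupersingular`, the frame point (`U.Pk`, `U.P`, `U.Ploc`),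
the Rapoport–Zink space `𝒩 = U.N`, «the new hermitian space `V̄ := Hom_k((A_{0k}, i_{0k}), (A_k, i_k))_ℚ` … (C.11), satisfying Lemma C.25»
= REAL `U.Vbar` (p. 86 L5–10), `Λ̄_𝔮 = U.Λbar`, `K̄_𝔮 = U.Kbar` (p. 85 L74–76), `ι_P` on groups = `U.iotaGrp` ((C.13), p. 86 L61–68); the §5.2
datum is instantiated at `(U.V, U.τ', U.S, U.𝔭)` (`extends Sec52IntData F E U.V U.τ' U.S U.𝔭`) with the compatibilities `K_level`, `Λ_eq`.
REAL here: the canonical integral model (tree `CanonicalIntegralModel`, Def. C.21: `𝒳_K = 𝒳int.total K K_level`), the index vectors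
`x ∈ V(E)^+` (Def. 5.3 «the subset consisting of `x` such that `(x, x)_V` is totally positive»), the away-from-`𝔭̲` elements `g^p ∈
U(V)(𝔸_F^{∞,p})` (tree `awayFrom`, READING U4), the moduli spaces of Def. 5.21 as Mathlib schemes with a morphism to `𝒳^{nr}_K` (so that Prop.
5.22 (1) «finite, unramified» are Mathlib's `IsFinite`, `FormallyUnramified`), the completed local rings of Prop. 5.22 (3) as commutative rings.
⟨CARRIER⟩: the remaining objects named above, each with its printed meaning quoted; READING Q (module docstring) for the index sets.
Nothing is asserted. [cite: Liu2021, §5.3 (pp. 80–90)] -/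
structure Sec53Data (U : UniformizationData F E) extends Sec52IntData F E U.V U.τ' U.S U.𝔭 where
  /-- the level `K` is of the form `K = K^{𝔭̲} × ∏_{𝔮∈𝔭̲} K_𝔮` of App. C §C.4 (tree `Setup.IsLevel`; its `𝔮`-components are `U.Kat 𝔮` by
  `U.map_evalPlace_of_isLevel`), so that `𝒳_K` (Def. C.21) is defined. REAL hypothesis. -/
  K_level : U.IsLevel K
  /-- the Def. 5.16 frames of the §5.2 datum are App. C's: `Λ_𝔮 = U.Λ 𝔮` for `𝔮 ∈ 𝔭̲` (l. 4912 «we may choose a self-dual lattice `Λ_𝔮`»). REAL. -/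
  Λ_eq : ∀ 𝔮 ∈ inertSet E U.𝔭, Λ 𝔮 = U.Λ 𝔮
  /-- «Let `𝒳_K` be the canonical integral model of `X_K` over `𝒪_{E_𝔭}` (Definition C.21)» (p. 79 L12–13) — the tree's datum of Prop. C.20 /
  Def. C.21 (`𝒳_K = 𝒳int.total K K_level`, a scheme over `𝒪_{E_𝔭}`). -/
  𝒳int : CanonicalIntegralModel F E U.toSetup
  /-- «`vol(K)`», the canonical volume of `K` (Def. 4.22 (3); squad file `Sec42AlbaneseUnitaryShimuraII` (TL-t03)); Theorem 5.25: «`dḡ` is the Haar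
  measure on `U(V̄)(𝔸_F^{∞,p})` such that `K̄^p` has volume `vol(K)`». -/
  vol : ℝ
  /-- «Now we take a frame» (p. 81 L28; Def. 5.20), over `U`. -/
  frame : Frame F E U
  /-- ⟨CARRIER⟩ `𝒳^{nr}_K(k)`, the `k`-points of `𝒳^{nr}_K := 𝒳_K ⊗_{𝒪_{E_𝔭}} 𝒪_{E_𝔭^{nr}}`, `k` the residue field of `𝒪_{E_𝔭^{nr}}` (p. 81 L28–31;
  Lem. 5.24 «a point `y ∈ 𝒳^{nr}_K(k)`»). -/
  kPts : Type
  /-- ⟨CARRIER⟩ the `k`-points of `𝓜(V, W_0^∞, Φ)^{nr}_{K,L_0}` (the lower-left corner of (5.10)). -/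
  MKPts : Type
  /-- ⟨CARRIER⟩ the left vertical arrow `𝒳^{nr}_K → 𝓜(V, W_0^∞, Φ)^{nr}_{K,L_0}` of (5.10) on `k`-points (p. 81 L32–48). -/
  vert : kPts → MKPts
  /-- ⟨CARRIER⟩ «the natural quotient morphism `𝓜(V, W_0^∞, Φ)_{K_p,L_0} → 𝓜(V, W_0^∞, Φ)_{K,L_0}`» (p. 85 L42–43) on `k`-points, from `U.kPts`. -/
  quot : U.kPts → MKPts
  /-- ⟨CARRIER⟩ the support, on `k`-points of `𝒳^{nr}_K × 𝒳^{nr}_K`, of a cycle on `𝒳_K × 𝒳_K` (complex coefficients: union of the components with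
  nonzero coefficient) base-changed to `𝒪_{E_𝔭^{nr}}` (Lem. 5.24: «`(y, y)` belongs to both `T^f_K` and the support of `Δ 𝒵(φ)_K`»). -/
  supp2 : ∀ i, ZcI 2 i → Set (kPts × kPts)
  /-- ⟨CARRIER⟩ the index set «`U(V)(F)\V(E)^+`» of Kudla's generating series (p. 72 L9–10; Cor. 5.23, p. 84 L50), `V(E)^+ ⊆ V(E)` «the subset
  consisting of `x` such that `(x, x)_V` is totally positive» (Def. 5.3, p. 71), as a type with a representative map (READING Q). -/
  XIdx : Type
  /-- the representative `x ∈ V(E)^+` (coordinates of `V.basis`) of a class in `U(V)(F)\V(E)^+`. -/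
  xRep : XIdx → (Fin U.V.n → E)
  /-- ⟨CARRIER LAW⟩ representatives lie in `V(E)^+`: `(x, x)_V ∈ F` is totally positive (Def. 5.3). REAL condition. -/
  xRep_pos : ∀ ι, ∃ a : F, algebraMap F E a = Sec52Defs.formCoord U.V (xRep ι) (xRep ι) ∧ ∀ σ : F →+* ℝ, 0 < σ a
  /-- ⟨CARRIER⟩ the index set «`g^p ∈ U(V_x)(𝔸_F^{∞,p})\U(V)(𝔸_F^{∞,p})/K^p`» of Cor. 5.23 (p. 84 L54–58) for the class of `x`, `V_x` «its orthogonal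
  complement in `V`» (Def. 5.3), as a type with a representative map into `U(V)(𝔸_F^{∞,p}) = U(V)(𝔸_F^{∞,𝔭̲})` (tree `awayFrom`, READING U4/Q). -/
  GIdx : XIdx → Type
  /-- the representative «`g^p = (g^p, g_𝔮 | 𝔮 ∈ Spl_p) ∈ U(V)(𝔸_F^{∞,p})`» (Def. 5.21, p. 81 L56–57) of a double class. -/
  gRep : ∀ ι, GIdx ι → awayFrom U.V (inertSet E U.𝔭)
  /-- ⟨CARRIER⟩ `𝒳^{nr}_K` as a scheme (the target of the relative functors `s_{x,g^p}`, Def. 5.21). -/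
  Xnr : AlgebraicGeometry.Scheme.{0}
  /-- ⟨CARRIER⟩ `Z(x, g^p)^{nr}_K`, the source of «the relative functor `s_{x,g^p} : Z(x, g^p)^{nr}_K → 𝒳^{nr}_K`» of Def. 5.21 (p. 81 L54 – p. 82 L17:
  «the fiber over a point `(A_0, i_0, λ_0, η_0^p; A, i, λ, η^p, η_p^{spl}) ∈ 𝒳^{nr}_K(S)` consists of `ρ ∈ Hom_S((A_0, i_0), (A, i_A)) ⊗_{𝒪_F} 𝒪_{F,(p)}`
  such that for every geometric point `s` of `S`, • the element `ρ_* ∈ Hom_{E⊗_ℚ𝔸^{∞,p}}(H^{ét}_1(A_{0s}, 𝔸^{∞,p}), H^{ét}_1(A_s, 𝔸^{∞,p}))` belongs to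
  `η^p((g^p)^{−1} x)`, • the element `ρ_* ∈ ⊕_{𝔮 ∈ Spl_p} Hom_{𝒪_{E_{𝔮^−}}}(A_{0s}[(𝔮^−)^∞], A_s[(𝔮^−)^∞]) ⊗_{𝒪_{E_{𝔮^−}}} E_{𝔮^−}` belongs to
  `η_p^{spl}((g_𝔮^{−1} x)_{𝔮 ∈ Spl_p})`»; `𝔮^− = U.qMinus 𝔮`), typed as a scheme (Prop. 5.22 (1) «representable» is thereby part of the typing). -/
  Znr : ∀ ι, GIdx ι → AlgebraicGeometry.Scheme.{0}
  /-- ⟨CARRIER⟩ the morphism `s_{x,g^p} : Z(x, g^p)^{nr}_K → 𝒳^{nr}_K` (Def. 5.21). -/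
  sMor : ∀ ι (γ : GIdx ι), Znr ι γ ⟶ Xnr
  /-- ⟨CARRIER⟩ the relative functors over `X_K ⊗_E E_𝔭^{nr}` (Prop. 5.22 (2), p. 82 L23–33), a carrier type of which the next three fields are
  elements / constructions. -/
  RelFun : Type
  /-- ⟨CARRIER⟩ the generic fibre `s_{x,g^p} ⊗_{𝒪_{E_𝔭^{nr}}} E_𝔭^{nr}` as a relative functor over `X_K ⊗_E E_𝔭^{nr}` (Prop. 5.22 (2)). -/
  genericFibre : ∀ ι, GIdx ι → RelFun
  /-- ⟨CARRIER⟩ the index set of Prop. 5.22 (2): «`(g_𝔮 | 𝔮 ∈ 𝔭̲), g_𝔮 ∈ U(V_x)(F_𝔮)\U(V)(F_𝔮)/K_𝔮, g_𝔮^{−1} x ∈ Λ_𝔮`» (p. 82 L28–30), for the class of `x`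
  (READING Q). -/
  QIdx : XIdx → Type
  /-- ⟨CARRIER⟩ «`s_{x,(g^p, g_𝔮 | 𝔮 ∈ 𝔭̲)} ⊗_E E_𝔭^{nr}`», the base change of the morphism `s_{x,g}` of Definition 5.3 (§5.1; squad file
  `Sec51DoublingFormulaCMData` (TL-t12)) for `g = (g^p, (g_𝔮)_{𝔮 ∈ 𝔭̲})`, as a relative functor over `X_K ⊗_E E_𝔭^{nr}` (Prop. 5.22 (2)). -/
  sGeneric : ∀ ι, GIdx ι → QIdx ι → RelFun
  /-- ⟨CARRIER⟩ the disjoint union `∐_j R_j` of a family of relative functors over `X_K ⊗_E E_𝔭^{nr}` (Prop. 5.22 (2)). -/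
  coprodRel : ∀ {J : Type}, (J → RelFun) → RelFun
  /-- ⟨CARRIER⟩ «there is an isomorphism … of relative functors over `X_K ⊗_E E_𝔭^{nr}`» (Prop. 5.22 (2)): isomorphy of two relative functors. -/
  IsoRel : RelFun → RelFun → Prop
  /-- ⟨CARRIER⟩ `Z(x, g)^{nr}_K(k)`, the `k`-points of `Z(x, g^p)^{nr}_K` (Prop. 5.22 (3): «For every point `z ∈ Z(x, g)^{nr}_K(k)`»). -/
  ZkPts : ∀ ι, GIdx ι → Type
  /-- ⟨CARRIER⟩ `y := s_{x,g^p}(z) ∈ 𝒳^{nr}_K(k)` (Prop. 5.22 (3)). -/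
  sPt : ∀ ι (γ : GIdx ι), ZkPts ι γ → kPts
  /-- ⟨CARRIER⟩ «`R_y` … completed local ring of `𝒳^{nr}_K` … at `y`» (Prop. 5.22 (3), p. 82 L37–38), as commutative rings. -/
  Ry : kPts → CommRingCat.{0}
  /-- ⟨CARRIER⟩ «`R_z` … completed local ring of … `Z(x, g)^{nr}_K` at `z`» (p. 82 L37–38). -/
  Rz : ∀ ι (γ : GIdx ι), ZkPts ι γ → CommRingCat.{0}
  /-- ⟨CARRIER⟩ «the induced ring homomorphism `R_y → R_z`» (p. 82 L35–36). -/
  sHom : ∀ ι (γ : GIdx ι) (z : ZkPts ι γ), Ry (sPt ι γ z) ⟶ Rz ι γ z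
  /-- ⟨CARRIER⟩ the cycles of codimension `1` with complex coefficients on `𝒳^{nr}_K`, `Z¹_ℂ(𝒳^{nr}_K)` (Cor. 5.23: «as a formal series in `Z¹_ℂ(𝒳^{nr}_K)`»;
  READING FS). -/
  ZcNr : ModuleCat.{0} ℂ
  /-- ⟨CARRIER⟩ base change `Z¹(𝒳_K)_ℂ → Z¹_ℂ(𝒳^{nr}_K)`, `Z ↦ Z ⊗_{𝒪_{E_𝔭}} 𝒪_{E_𝔭^{nr}}` (Cor. 5.23: «`𝒵(φ)_K ⊗_{𝒪_{E_𝔭}} 𝒪_{E_𝔭^{nr}}`»), `ℂ`-linearly. -/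
  toNr : ZcI 1 1 →ₗ[ℂ] ZcNr
  /-- ⟨CARRIER⟩ the relative divisor «`(s_{x,g^p})_* Z(x, g^p)^{nr}_K`», «again [denoted] by `Z(x, g^p)^{nr}_K`» (p. 84 L37–43), in `Z¹_ℂ(𝒳^{nr}_K)`. -/
  Zxg : ∀ ι, GIdx ι → ZcNr
  /-- ⟨CARRIER⟩ the `F_𝔮`-algebra structure of `E_{𝔮^−}` (`𝔮^− = U.qMinus 𝔮` the chosen prime of `E` over `𝔮`; for `𝔮 ∈ 𝔭̲` the unique one):
  the continuous extension of `F → E`, as data (no global instance between the two Mathlib completions is available); pinned by `algLoc_comp`. -/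
  algLoc : ∀ 𝔮 : HeightOneSpectrum (𝓞 F), Algebra (𝔮.adicCompletion F) ((U.qMinus 𝔮).1.adicCompletion E)
  /-- ⟨CARRIER LAW⟩ `F → F_𝔮 → E_{𝔮^−}` = `F → E → E_{𝔮^−}`. REAL. -/
  algLoc_comp : ∀ 𝔮 (a : F), @algebraMap (𝔮.adicCompletion F) ((U.qMinus 𝔮).1.adicCompletion E) _ _ (algLoc 𝔮)
      (algebraMap F (𝔮.adicCompletion F) a) = algebraMap E ((U.qMinus 𝔮).1.adicCompletion E) (algebraMap F E a)
  /-- The LOCAL data of [Liu2021, §1.3] at `E_𝔮/F_𝔮` for every finite place `𝔮` (used for `𝔮 ∈ 𝔭̲`): the tree's datum ★ `Sec13to16IntroductionAFL.Sec13Data`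
  (TL-t02) — `S_n(F_𝔮)`, `M_n(F_𝔮)`, regular semisimple pairs, `ω_𝔮 = transferFactor`, `Orb(s; f, φ; ζ, y)` = `orb`, `𝟙_{S_n(𝒪_{F_𝔮})} = oneS`,
  `𝟙_{M_n(𝒪_{F_𝔮})} = oneM`, the hermitian spaces `V_n^±` over `E_𝔮` with `U(V_n^±)(F_𝔮)`, the integral `intPlus` of 1.9 (2), and at `𝔭` the Rapoport–Zink
  data `𝒵_n(x)`, `χ(𝒪_{Γ_ξ} ⊗^𝕃_{𝒪_{𝒩_n²}} 𝒪_{Δ𝒵_n(x)}) = chiInt` of 1.12 — «Since the question is purely local» (p. 11 L50); p. 86 footnote 15: «Comparing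
  the notations with those in Subsection 1.3, we have `(X_k, i_k, λ_k) = (X_n, i_n, λ_n)`, `𝒩 = 𝒩_n`, and `V̄ ⊗_F F_𝔭 = V_n^−`».  (ED.2, squad QA-9/QA-10:
  the §5.3 statements below speak THIS vocabulary at the local places instead of parallel carriers.) -/
  loc13 : ∀ 𝔮 : HeightOneSpectrum (𝓞 F),
    @Sec13Data.{0} (𝔮.adicCompletion F) ((U.qMinus 𝔮).1.adicCompletion E) _ _ (algLoc 𝔮)
  /-- ⟨CARRIER LAW⟩ the local data have rank `n = dim V̄` (Lemma C.25 (1): `= dim V`). -/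
  loc13_n : ∀ 𝔮, (loc13 𝔮).n = U.Vbar.n
  /-- ⟨CARRIER⟩ `U(V̄)(F) → U(V̄ ⊗_F F_𝔮)(F_𝔮) = U(V_n^δ)(F_𝔮)` of the local datum: `δ = +` («`true`») for `𝔮 ∈ 𝔭̲ ∖ {𝔭}` (`V̄ ⊗_F F_𝔮 ≅ V ⊗_F F_𝔮`
  admits the self-dual lattice `Λ̄_𝔮`, Lemma C.25 (6)), `δ = −` («`false`») at `𝔮 = 𝔭` (Lemma C.25 (7); footnote 15 «`V̄ ⊗_F F_𝔭 = V_n^−`»); other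
  `(𝔮, δ)` unused. -/
  toLocU : ∀ 𝔮 (δ : Bool), U.Vbar.rationalPoints → (loc13 𝔮).U δ
  /-- ⟨CARRIER⟩ `V̄(E) → V̄ ⊗_F F_𝔮 = V_n^δ(E_𝔮)` of the local datum (coordinates of `V̄.basis`; same convention on `(𝔮, δ)`). -/
  toLocV : ∀ 𝔮 (δ : Bool), (Fin U.Vbar.n → E) → (loc13 𝔮).V δ
  /-- ⟨CARRIER⟩ a global pair `(ζ, y) ∈ S_n(F) × M_n(F)` read at `𝔮`: `(ζ, y) ∈ S_n(F_𝔮) × M_n(F_𝔮)` of the local datum (entrywise `E → E_{𝔮^−}`,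
  `F → F_𝔮`; Cor. 5.28 «`ω_𝔮(ζ, y) Orb(s; 𝟙_{S_n(𝒪_{F_𝔮})}, 𝟙_{M_n(𝒪_{F_𝔮})}; ζ, y)`» for the global matching orbit `(ζ, y)`). -/
  toLocGL : ∀ 𝔮, (symmSpace (n := U.Vbar.n) (conj F E : E →+* E) × MnPts F U.Vbar.n) →
    Matrix (Fin (loc13 𝔮).n) (Fin (loc13 𝔮).n) ((U.qMinus 𝔮).1.adicCompletion E) × (loc13 𝔮).Mn
  /-- ⟨CARRIER⟩ «the Euler–Poincaré characteristic appearing in the formula is finite» (Thm. 5.25, last sentence, p. 86 L75–77), for a pair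
  `(ξ, x) ∈ U(V_n^−)(F_𝔭) × V_n^−(E_𝔭)` of the local datum at `𝔭` (the value itself is ★ `(loc13 𝔭).chiInt`). -/
  IsChiFinite : (loc13 U.𝔭).U false → (loc13 U.𝔭).V false → Prop
  /-- ⟨CARRIER⟩ the orbital integral of Theorem 5.25 (p. 86 L34–74): «we define the orbital integral as
  `Orb(f̄^p, φ̄^p; ξ̄, x̄) := ∫_{U(V̄)(𝔸_F^{∞,p})} f̄^p(ḡ^{−1} ξ̄ ḡ) φ̄^p(ḡ^{−1} x̄) dḡ`, where • `f̄^p = f̄^{𝔭̲} ⊗ ⊗_{𝔮 ∈ 𝔭̲∖{𝔭}} f̄_𝔮` in which `f̄^{𝔭̲} = f^p` under the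
  isomorphism `ι_P` (C.13), and `f̄_𝔮 = 𝟙_{K̄_𝔮}`, • `φ̄^p = φ̄^{𝔭̲} ⊗ ⊗_{𝔮 ∈ 𝔭̲∖{𝔭}} φ̄_𝔮` in which `φ̄^{𝔭̲} = φ^p` under the isomorphism `ι_P`, and `φ̄_𝔮 = 𝟙_{Λ̄_𝔮}`, •
  `dḡ` is the Haar measure on `U(V̄)(𝔸_F^{∞,p})` such that `K̄^p` has volume `vol(K)`» (with `K̄^p = K̄^{𝔭̲} × ∏_{𝔮 ∈ 𝔭̲∖{𝔭}} K̄_𝔮`, `K̄^{𝔭̲} = K^p` under `ι_P`,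
  `K̄_𝔮 = U.Kbar 𝔮` the stabilizer of `Λ̄_𝔮 = U.Λbar 𝔮` of Lemma C.25 (6), p. 85 L69–76; `ι_P = U.iotaGrp`; `f^p = fp`, `φ^p = φp` of the §5.2 datum), as a
  function of `(ξ̄, x̄) ∈ U(V̄)(F) × V̄(E)` (coordinates of `V̄.basis`). -/
  Orb : U.Vbar.rationalPoints → (Fin U.Vbar.n → E) → ℂ
  /-- ⟨CARRIER⟩ the factor «`Orb(f̄^{𝔭̲}, φ̄^{𝔭̲}; ξ̄, x̄)`» of Remark 5.26's decomposition (p. 88 L40–57; Haar measure giving each `K̄_𝔮`, `𝔮 ∈ 𝔭̲ ∖ {𝔭}`,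
  volume `1`). -/
  OrbAway : U.Vbar.rationalPoints → (Fin U.Vbar.n → E) → ℂ
  /-- ⟨CARRIER⟩ the local factors «`Orb(𝟙_{K̄_𝔮}, 𝟙_{Λ̄_𝔮}; ξ̄, x̄)`», `𝔮 ∈ 𝔭̲ ∖ {𝔭}`, of Remark 5.26 (p. 88 L47–52). -/
  OrbLoc : HeightOneSpectrum (𝓞 F) → U.Vbar.rationalPoints → (Fin U.Vbar.n → E) → ℂ
variable {F E}

/-- `[U(V̄)(F) × V̄(E)]_{rs}` (Def. 5.14 with `F' = F`), the regular semisimple `U(V̄)(F)`-orbits in the coordinates of `V̄.basis`. REAL.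
[cite: Liu2021, Thm. 5.25 (p. 86)] -/
abbrev rsOrbitsBar (U : UniformizationData F E) : Set (Set (Sec52Defs.RelPair U.Vbar.rationalPoints)) := Sec52Defs.relOrbitsRS U.Vbar.rationalPoints

/-- **[Liu2021, Definition 5.27 (4)] (matching)** (p. 89 L22–27): «We say that two regular semisimple orbits `(ζ, y) ∈ [S_n(F') × M_n(F')]_{rs}` and
`(ξ̄, x̄) ∈ [U(V̄)(F') × V̄(E')]_{rs}` (Definition 5.14) *match* if • `ζ` and `ξ̄` have the same characteristic polynomial as elements in `Mat_{n,n}(E')`, •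
`y_2 ζ^i y_1 = (ξ̄^i x̄, x̄)_V̄` for `0 ≤ i ≤ n − 1`.»  Typed at `F' = F` (`E' = E`, the case used by Cor. 5.28: the GLOBAL matching orbit) on
representatives (both conditions are orbit invariants); BRIDGE (ED.2): the local matching at `F' = F_𝔮` is ★ `Sec13Data.Matches` of `Sec53Data.loc13 𝔮`
(used in `Sec53Data.RFL` / `AFL`). REAL. [cite: Liu2021, Def. 5.27 (4) (p. 89)] -/
def Matches (U : UniformizationData F E) (ζy : symmSpace (n := U.Vbar.n) (conj F E : E →+* E) × MnPts F U.Vbar.n)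
    (ξx : Sec52Defs.RelPair U.Vbar.rationalPoints) : Prop :=
  (ζy.1 : Matrix (Fin U.Vbar.n) (Fin U.Vbar.n) E).charpoly =
      ((ξx.1 : GL (Fin U.Vbar.n) E) : Matrix (Fin U.Vbar.n) (Fin U.Vbar.n) E).charpoly ∧
    ∀ i : ℕ, i < U.Vbar.n →
      (fun k => algebraMap F E (ζy.2.2 k)) ⬝ᵥ
          (((ζy.1 : Matrix (Fin U.Vbar.n) (Fin U.Vbar.n) E) ^ i) *ᵥ fun k => algebraMap F E (ζy.2.1 k)) =
        Sec52Defs.formCoord U.Vbar ((((ξx.1 : GL (Fin U.Vbar.n) E) : Matrix (Fin U.Vbar.n) (Fin U.Vbar.n) E) ^ i) *ᵥ ξx.2) ξx.2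

namespace Sec53Data

variable {U : UniformizationData F E} (D : Sec53Data F E U)

/-- `χ(𝒪_{Γ_ξ̄} ⊗^𝕃_{𝒪_{𝒩²}} 𝒪_{ΔZ(x̄)})` of Theorem 5.25 (p. 86 L32) for a rational pair `(ξ̄, x̄) ∈ U(V̄)(F) × V̄(E)`: «Applying the constructions from Subsection
1.3, we have for every nonzero `x̄ ∈ V̄(E_𝔭)`, a sub-formal scheme `Z(x̄)` of `𝒩`; and for every `ḡ ∈ U(V̄)(F_𝔭)`, an isomorphism `ḡ : 𝒩 → 𝒩` with its graph
`Γ_ḡ ⊆ 𝒩²`» (p. 86 L11–13) with footnote 15 «`𝒩 = 𝒩_n` and `V̄ ⊗_F F_𝔭 = V_n^−`» — i.e. the local datum's ★ `Sec13Data.chiInt` (Def. 1.11 / 1.12) at the image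
of `(ξ̄, x̄)` in `U(V_n^−)(F_𝔭) × V_n^−(E_𝔭)` (ED.2, squad QA-9/QA-10: ★ vocabulary instead of a parallel carrier). REAL over the carriers.
[cite: Liu2021, Thm. 5.25 (p. 86)] -/
def chiN (ξ : U.Vbar.rationalPoints) (x : Fin U.Vbar.n → E) : ℤ :=
  letI := D.algLoc U.𝔭
  (D.loc13 U.𝔭).chiInt (D.toLocU U.𝔭 false ξ) (D.toLocV U.𝔭 false x)

/-- «`Orb(s; 𝟙_{S_n(𝒪_{F_𝔮})}, 𝟙_{M_n(𝒪_{F_𝔮})}; ζ, y)`» (Cor. 5.28) for a global pair `(ζ, y)` read at `𝔮` = the local datum's ★ `Sec13Data.orb s oneS oneM` (§1.3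
p. 12 L28–35). REAL over the carriers (ED.2). [cite: Liu2021, Cor. 5.28 (p. 89)] -/
def OrbGL (𝔮 : HeightOneSpectrum (𝓞 F)) (s : ℂ) (ζy : symmSpace (n := U.Vbar.n) (conj F E : E →+* E) × MnPts F U.Vbar.n) : ℂ :=
  letI := D.algLoc 𝔮
  (D.loc13 𝔮).orb s (D.loc13 𝔮).oneS (D.loc13 𝔮).oneM (D.toLocGL 𝔮 ζy).1 (D.toLocGL 𝔮 ζy).2

/-- The local transfer factor «`ω_𝔮(ζ, y)`» of Def. 5.27 (3) for a global pair `(ζ, y)` read at `𝔮` = the local datum's ★ `Sec13Data.transferFactor`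
(«`ω(ζ, y) := μ_{E/F}(det(y₁, ζy₁, …, ζ^{n−1}y₁))`», §1.3 p. 12 L5–7; the generic `transferFactor μ` above is the same formula for an arbitrary `μ`).
REAL over the carriers (ED.2). [cite: Liu2021, Def. 5.27 (3) (p. 89)] -/
def omegaAt (𝔮 : HeightOneSpectrum (𝓞 F)) (ζy : symmSpace (n := U.Vbar.n) (conj F E : E →+* E) × MnPts F U.Vbar.n) : ℂ :=
  letI := D.algLoc 𝔮
  (D.loc13 𝔮).transferFactor (D.toLocGL 𝔮 ζy).1 (D.toLocGL 𝔮 ζy).2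

/-- Hypothesis of Cor. 5.28 at a place `𝔮 ∈ 𝔭̲ ∖ {𝔭}`: «[the statement 1.9 (2)] for `E_𝔮/F_𝔮`» holds at the orbit of `(ξ̄, x̄)` — the BODY of the tree's
★ `Sec13Data.Stmt19_2` (TL-t02; p. 12 L43 – p. 13 L13: «`ω(ζ, y) Orb(0; 𝟙_{S_n(𝒪_F)}, 𝟙_{M_n(𝒪_F)}; ζ, y) = ∫_{U(V_n^+)} 𝟙_{K_n}(g⁻¹ξg) 𝟙_{Λ_n}(g⁻¹x) dg` where
`(ξ, x)` … is the unique orbit that matches `(ζ, y)`») specialised — LITERALLY, hypothesis by hypothesis incl. `IsRSU` (squad QA-14) — to the local pairs matching the image of `(ξ̄, x̄)` in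
`U(V_n^+)(F_𝔮) × V_n^+(E_𝔮)` (status: ★ `Rem110_2`, known for `p` large). REAL over the carriers (ED.2, squad QA-10). [cite: Liu2021, Cor. 5.28 (p. 89); §1.3 (1.9 (2)) (pp. 12–13)] -/
def RFL (𝔮 : HeightOneSpectrum (𝓞 F)) (ξ : U.Vbar.rationalPoints) (x : Fin U.Vbar.n → E) : Prop :=
  letI := D.algLoc 𝔮
  ∀ (ζ : Matrix (Fin (D.loc13 𝔮).n) (Fin (D.loc13 𝔮).n) ((U.qMinus 𝔮).1.adicCompletion E)) (y : (D.loc13 𝔮).Mn),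
    ζ ∈ (D.loc13 𝔮).Sn → (D.loc13 𝔮).IsRS ζ y → (D.loc13 𝔮).IsPlus ζ y →
      (D.loc13 𝔮).IsRSU true (D.toLocU 𝔮 true ξ) (D.toLocV 𝔮 true x) →
      (D.loc13 𝔮).Matches ζ y true (D.toLocU 𝔮 true ξ) (D.toLocV 𝔮 true x) →
        (D.loc13 𝔮).transferFactor ζ y * (D.loc13 𝔮).orb 0 (D.loc13 𝔮).oneS (D.loc13 𝔮).oneM ζ y =
          (D.loc13 𝔮).intPlus (D.toLocU 𝔮 true ξ) (D.toLocV 𝔮 true x)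

/-- Hypothesis of Cor. 5.28 at `𝔭`: «[the statement 1.12] for `E_𝔭/F_𝔭`» holds at the orbit of `(ξ̄, x̄)` — the BODY of the tree's ★ `Sec13Data.Item112AsPrinted`
(TL-t02; p. 14 L34–43: «`−ω(ζ, y) (d/ds)|_{s=0} Orb(s; 𝟙_{S_n(𝒪_F)}, 𝟙_{M_n(𝒪_F)}; ζ, y) = 2 log q · χ(𝒪_{Γ_ξ} ⊗^𝕃_{𝒪_{𝒩_n²}} 𝒪_{Δ𝒵_n(x)})`, where `(ξ, x) ∈
[U(V_n^−)(F) × V_n^−(E)]_{rs}` is the unique orbit that matches `(ζ, y)`») specialised — LITERALLY, incl. `IsRSU` (squad QA-14) — to the local pairs matching the image of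
`(ξ̄, x̄)` in `U(V_n^−)(F_𝔭) × V_n^−(E_𝔭)` (status: ★ `Rem113_1`, `Rem113_2`, `Rem114` = App. A minuscule case). REAL over the carriers (ED.2, squad QA-10).
[cite: Liu2021, Cor. 5.28 (p. 89); §1.3 (1.12) (p. 14)] -/
def AFL (ξ : U.Vbar.rationalPoints) (x : Fin U.Vbar.n → E) : Prop :=
  letI := D.algLoc U.𝔭
  ∀ (ζ : Matrix (Fin (D.loc13 U.𝔭).n) (Fin (D.loc13 U.𝔭).n) ((U.qMinus U.𝔭).1.adicCompletion E)) (y : (D.loc13 U.𝔭).Mn),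
    ζ ∈ (D.loc13 U.𝔭).Sn → (D.loc13 U.𝔭).IsRS ζ y → (D.loc13 U.𝔭).IsMinus ζ y →
      (D.loc13 U.𝔭).IsRSU false (D.toLocU U.𝔭 false ξ) (D.toLocV U.𝔭 false x) →
      (D.loc13 U.𝔭).Matches ζ y false (D.toLocU U.𝔭 false ξ) (D.toLocV U.𝔭 false x) →
        -((D.loc13 U.𝔭).transferFactor ζ y *
            deriv (fun s : ℂ => (D.loc13 U.𝔭).orb s (D.loc13 U.𝔭).oneS (D.loc13 U.𝔭).oneM ζ y) 0) =
          (2 * Real.log (D.loc13 U.𝔭).q : ℂ) * ((D.loc13 U.𝔭).chiInt (D.toLocU U.𝔭 false ξ) (D.toLocV U.𝔭 false x) : ℂ)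

/-- «Define `𝒳^{ss}_K` to be the preimage of `𝓜(V, W_0^∞, Φ)^{ss}_{K,L_0}` under the left vertical morphism in the diagram (5.10)» (p. 85 L44–49), where
«we define `𝓜(V, W_0^∞, Φ)^{ss}_{K,L_0}` to be the image of `𝓜(V, W_0^∞, Φ)^{ss}_{K_p,L_0}` under the natural quotient morphism» (p. 85 L40–43) and the
supersingular locus `𝓜^{ss}_{K_p,L_0}` is Definition C.24 (tree `U.IsSupersingular`): `y ∈ 𝒳^{nr}_K(k)` is supersingular. REAL over the carriers.
[cite: Liu2021, §5.3 (p. 85 L36–49)] -/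
def IsSupersingularPt (y : D.kPts) : Prop := ∃ z : U.kPts, U.IsSupersingular z ∧ D.quot z = D.vert y

/-- **[Liu2021, Proposition 5.22 (1)] AS PRINTED** (p. 82 L19–22): «For `x ∈ V(E)^+` and `g^p ∈ U(V)(𝔸_F^{∞,p})`, we have (1) The relative morphism
`s_{x,g^p}` is representable, finite, and unramified» — for the carried representatives `(x, g^p)`; representability is part of the typing of
`Z(x, g^p)^{nr}_K` as a scheme; «finite» = Mathlib `IsFinite`, «unramified» = Mathlib `FormallyUnramified` (with finiteness). NO PROOF.
[cite: Liu2021, Prop. 5.22 (1) (p. 82)] -/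
def Prop522_1 : Prop :=
  ∀ ι (γ : D.GIdx ι), AlgebraicGeometry.IsFinite (D.sMor ι γ) ∧ AlgebraicGeometry.FormallyUnramified (D.sMor ι γ)

/-- **[Liu2021, Proposition 5.22 (2)] AS PRINTED** (p. 82 L23–33): «(2) There is an isomorphism
`s_{x,g^p} ⊗_{𝒪_{E_𝔭^{nr}}} E_𝔭^{nr} ≃ ∐_{(g_𝔮 | 𝔮 ∈ 𝔭̲), g_𝔮 ∈ U(V_x)(F_𝔮)\U(V)(F_𝔮)/K_𝔮, g_𝔮^{−1} x ∈ Λ_𝔮} s_{x,(g^p, g_𝔮 | 𝔮 ∈ 𝔭̲)} ⊗_E E_𝔭^{nr}` of relative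
functors over `X_K ⊗_E E_𝔭^{nr}`, where `s_{x,(g^p, g_𝔮 | 𝔮 ∈ 𝔭̲)}` is defined in Definition 5.3» — over the carriers. NO PROOF.
[cite: Liu2021, Prop. 5.22 (2) (p. 82)] -/
def Prop522_2 : Prop :=
  ∀ ι (γ : D.GIdx ι), D.IsoRel (D.genericFibre ι γ) (D.coprodRel fun j : D.QIdx ι => D.sGeneric ι γ j)

/-- **[Liu2021, Proposition 5.22 (3)] AS PRINTED** (p. 82 L34–38): «(3) For every point `z ∈ Z(x, g)^{nr}_K(k)`, the induced ring homomorphism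
`R_y → R_z` is surjective whose kernel is a principal ideal that is not contained in `p R_y`. Here `R_z` (resp. `R_y`) denotes completed local
ring of `Z(x, g)^{nr}_K` (resp. `𝒳^{nr}_K`) at `z` (resp. `y := s_{x,g^p}(z)`).»  `p` = the residue characteristic of `𝔭` (tree `residueChar`). REAL
over the carried rings. NO PROOF. [cite: Liu2021, Prop. 5.22 (3) (p. 82)] -/
def Prop522_3 : Prop :=
  ∀ ι (γ : D.GIdx ι) (z : D.ZkPts ι γ),
    Function.Surjective (D.sHom ι γ z).hom ∧
      (RingHom.ker (D.sHom ι γ z).hom).IsPrincipal ∧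
        ¬ RingHom.ker (D.sHom ι γ z).hom ≤ Ideal.span {((residueChar U.𝔭 : ℕ) : D.Ry (D.sPt ι γ z))}

/-- **[Liu2021, Corollary 5.23] AS PRINTED** (p. 84 L45–63): «Let `𝔭` be a good inert prime. If `φ(0) = 0`, then we have
`𝒵(φ)_K ⊗_{𝒪_{E_𝔭}} 𝒪_{E_𝔭^{nr}} = ∑_{x ∈ U(V)(F)\V(E)^+} ∑_{g^p ∈ U(V_x)(𝔸_F^{∞,p})\U(V)(𝔸_F^{∞,p})/K^p} e^{−2π·Tr_{F/ℚ}(x,x)_V} φ^p((g^p)^{−1} x) Z(x, g^p)^{nr}_K`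
as a formal series in `Z¹_ℂ(𝒳^{nr}_K)`.»  READING FS: for every index `T`, the base change of (the closure of) the part of index `T` of `Z(φ)_K` is the
sum over the classes `x` with `(x, x)_V = T` and the double classes `g^p` (finite sums by READING Q; `∑ᶠ`) of `φ^p((g^p)^{−1}x) · Z(x, g^p)^{nr}_K`,
with `φ^p` the Def. 5.16 factor of `φ` evaluated on the away-from-`𝔭̲` components of `(g^p)^{−1} x`. NO PROOF. [cite: Liu2021, Cor. 5.23 (p. 84)] -/
def Cor523 : Prop :=
  D.φ 0 = 0 → ∀ T : E,
    D.toNr (D.closure 1 1 (D.Zphi D.φ T)) =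
      ∑ᶠ (ι : D.XIdx) (_ : Sec52Defs.formCoord U.V (D.xRep ι) (D.xRep ι) = T) (γ : D.GIdx ι),
        D.φp (awayV U.V (inertSet E U.𝔭)
          (Sec52Defs.vecAct U.V ((D.gRep ι γ : awayFrom U.V (inertSet E U.𝔭)) : U.V.Gfin)⁻¹
            fun i => algebraMap E _ (D.xRep ι i))) • D.Zxg ι γ

/-- **[Liu2021, Lemma 5.24] AS PRINTED** (p. 85 L5–10): «Let `K, f, φ` be as in Definition 5.12 such that `f ⊗ φ` is regularly supported at some
nonarchimedean place `v` of `F`. For a point `y ∈ 𝒳^{nr}_K(k)`, if `(y, y)` belongs to both `T^f_K` and the support of `Δ 𝒵(φ)_K`, then `y` is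
supersingular (Definition C.24).» (READING FS: `(y, y)` lies in the support of some part of `Δ 𝒵(φ)_K`.) NO PROOF. [cite: Liu2021, Lem. 5.24 (p. 85)] -/
def Lem524 : Prop :=
  (∃ v, Sec52Defs.IsRegularlySupportedAt U.V v (Sec52Defs.tensorFn U.V D.f D.φ)) →
    ∀ y : D.kPts, (y, y) ∈ D.supp2 _ D.TfI →
      (∃ T : E, (y, y) ∈ D.supp2 _ (D.diagEmbI 1 (D.closure 1 1 (D.Zphi D.φ T)))) → D.IsSupersingularPt y

/-- **[Liu2021, Theorem 5.25] (orbital decomposition) AS PRINTED** (p. 86 L16–77): «Let `K, f, φ` be as in Definition 5.12 such that `f ⊗ φ` is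
regularly supported at some nonarchimedean place `v` of `F`. For a good inert prime `𝔭`, we have
`I_K(f, φ)_𝔭 = 2 log |𝒪_F/𝔭| · ∑_{(ξ̄,x̄) ∈ [U(V̄)(F) × V̄(E)]_{rs}} e^{−2π·Tr_{F/ℚ}(x̄,x̄)_V̄} Orb(f̄^p, φ̄^p; ξ̄, x̄) · χ(𝒪_{Γ_ξ̄} ⊗^𝕃_{𝒪_{𝒩²}} 𝒪_{ΔZ(x̄)})` after
choosing a frame (Definition 5.20). […] In particular, the Euler–Poincaré characteristic appearing in the formula is finite for every regular
semisimple pair `(ξ̄, x̄)`.»  READING FS: for every index `T`, the part of index `T` of `I_K(f, φ)_𝔭` (for any doubling divisor `Z_K`) equals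
`2 log |𝒪_F/𝔭|` times the sum (`∑ᶠ`) over the regular semisimple orbits with `(x̄, x̄)_V̄ = T` of `Orb · χ`, the summand evaluated at any system
of representatives `ρ` of the orbits (the printed sum is over orbits); and `χ` is finite at every regular semisimple pair. NO PROOF.
[cite: Liu2021, Thm. 5.25 (p. 86)] -/
def Thm525 : Prop :=
  ∀ (hrs : ∃ v, Sec52Defs.IsRegularlySupportedAt U.V v (Sec52Defs.tensorFn U.V D.f D.φ)) (Z : D.Zc 2 1)
    (hZ : D.IsDoublingDivisor D.φ Z)
    (ρ : rsOrbitsBar U → Sec52Defs.RelPair U.Vbar.rationalPoints), (∀ O, ρ O ∈ O.1) →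
    (∀ T : E, D.IKp Z hZ hrs T =
      (twoLogNorm U.𝔭 : ℂ) *
        ∑ᶠ (O : rsOrbitsBar U) (_ : Sec52Defs.formCoord U.Vbar (ρ O).2 (ρ O).2 = T),
          D.Orb (ρ O).1 (ρ O).2 * (D.chiN (ρ O).1 (ρ O).2 : ℂ)) ∧
    ∀ (ξ : U.Vbar.rationalPoints) (x : Fin U.Vbar.n → E),
      Sec52Defs.IsRelRegularSemisimple (ξ : GL (Fin U.Vbar.n) E) x → D.IsChiFinite (D.toLocU U.𝔭 false ξ) (D.toLocV U.𝔭 false x)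

/-- **[Liu2021, Remark 5.26], the suggested general notion** (p. 88 L33–39): «We believe that a more general notion of good inert prime, for which a
result similar to Theorem 5.25 holds, should just be a prime `𝔭` of `F` that is inert in `E`, and such that there is a self-dual lattice `Λ_𝔭 ⊆ V(F_𝔭)`
satisfying • `K = K^𝔭 × K_𝔭` in which `K_𝔭` is the stabilizer of `Λ_𝔭`, • `f = f^𝔭 ⊗ f_𝔭` in which `f_𝔭 = 𝟙_{K_𝔭}`, • `φ = φ^𝔭 ⊗ φ_𝔭` in which `φ_𝔭 = 𝟙_{Λ_𝔭}`.»
Typed: ONLY the suggested notion, as a predicate on a prime `𝔮` over the §5.2 part of the datum (same vocabulary as Def. 5.16: a frame, tree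
`IsSelfDualFrame` / `latticeStabilizer`); the belief «a result similar to Theorem 5.25 holds» is an expectation, not a result, and is NOT typed.
REAL. [cite: Liu2021, Rem. 5.26 (p. 88)] -/
def Rem526Notion (𝔮 : HeightOneSpectrum (𝓞 F)) : Prop :=
  IsInert E 𝔮 ∧
  ∃ (Λ : UnitaryGroup.LocalGLPi E U.V.n 𝔮)
    (fp : ((u : {u : HeightOneSpectrum (𝓞 F) // u ∉ ({𝔮} : Set _)}) →
      UnitaryGroup.localPi E (conj F E) U.V.n U.V.gram u.1) → ℂ)
    (φp : ((w : {w : HeightOneSpectrum (𝓞 E) // w.under (𝓞 F) ∉ ({𝔮} : Set _)}) → Fin U.V.n → w.1.adicCompletion E) → ℂ),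
    IsSelfDualFrame U.V 𝔮 Λ ∧ Sec52Defs.levelAt U.V D.K 𝔮 = latticeStabilizer U.V 𝔮 Λ ∧
    (∀ g : U.V.Gfin, D.f g = fp (awayG U.V {𝔮} g) *
      Set.indicator (Sec52Defs.levelAt U.V D.K 𝔮 : Set _) (fun _ => (1 : ℂ))
        (UnitaryGroup.evalPlace F E (conj F E) U.V.n U.V.gram 𝔮 g)) ∧
    (∀ x : Sec52Defs.VAd U.V, D.φ x = φp (awayV U.V {𝔮} x) *
      Set.indicator (latticeOfFrame U.V 𝔮 Λ) (fun _ => (1 : ℂ)) (locV U.V 𝔮 x))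

/-- **[Liu2021, Remark 5.26], the decomposition of the orbital integral AS PRINTED** (p. 88 L40–57): «In the formula for `I_K(f, φ)_𝔭` in Theorem 5.25, the
orbital integral has the decomposition `Orb(f̄^p, φ̄^p; ξ̄, x̄) = Orb(f̄^{𝔭̲}, φ̄^{𝔭̲}; ξ̄, x̄) · ∏_{𝔮 ∈ 𝔭̲∖{𝔭}} Orb(𝟙_{K̄_𝔮}, 𝟙_{Λ̄_𝔮}; ξ̄, x̄)`, in which we decompose the Haar
measure on `U(V̄)(𝔸_F^{∞,p})` such that `K̄_𝔮` has volume `1` for every `𝔮 ∈ 𝔭̲ ∖ {𝔭}`» — for regular semisimple pairs, over the carriers (`∏ᶠ` over the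
finite set `𝔭̲ ∖ {𝔭}`). NO PROOF. [cite: Liu2021, Rem. 5.26 (p. 88)] -/
def Rem526Decomposition : Prop :=
  ∀ (ξ : U.Vbar.rationalPoints) (x : Fin U.Vbar.n → E), Sec52Defs.IsRelRegularSemisimple (ξ : GL (Fin U.Vbar.n) E) x →
    D.Orb ξ x = D.OrbAway ξ x * ∏ᶠ (𝔮 : HeightOneSpectrum (𝓞 F)) (_ : 𝔮 ∈ inertSet E U.𝔭 \ {U.𝔭}), D.OrbLoc 𝔮 ξ x

/-- **[Liu2021, Corollary 5.28] AS PRINTED** (p. 89 L29–53): «In the situation of Theorem 5.25, suppose that for every orbit `(ξ̄, x̄) ∈ [U(V̄)(F) × V̄(E)]_{rs}`,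
[the statement 1.9 (2) of Liu2021, §1.3] for `E_𝔮/F_𝔮` for every `𝔮 ∈ 𝔭̲ ∖ {𝔭}` and [the statement 1.12 of Liu2021, §1.3] for `E_𝔭/F_𝔭` hold. Then we have
`I_K(f, φ)_𝔭 = − ∑_{(ξ̄,x̄) ∈ [U(V̄)(F) × V̄(E)]_{rs}} e^{−2π·Tr_{F/ℚ}(x̄,x̄)_V̄} Orb(f̄^p, φ̄^p; ξ̄, x̄) · d/ds|_{s=0} (∏_{𝔮 ∈ 𝔭̲} ω_𝔮(ζ, y) Orb(s; 𝟙_{S_n(𝒪_{F_𝔮})}, 𝟙_{M_n(𝒪_{F_𝔮})}; ζ, y))`,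
where `(ζ, y) ∈ [S_n(F) × M_n(F)]_{rs}` is the unique orbit that matches `(ξ̄, x̄)`.»  The two hypotheses are the ⟨CARRIER⟩ fields `RFL`, `AFL` (their
printed numbers 1.9 (2) and 1.12 name statements that are open in general: Rem. 1.10, Rem. 1.13); READING FS as in `Thm525`; the summand is
evaluated at any representatives `ρ` of the orbits and any matching pairs `m` (uniqueness of the matching orbit is part of the printed sentence, not
re-asserted); `d/ds|_{s=0}` = Mathlib `deriv … 0`. NO PROOF. [cite: Liu2021, Cor. 5.28 (p. 89)] -/
def Cor528 : Prop :=
  ∀ (hrs : ∃ v, Sec52Defs.IsRegularlySupportedAt U.V v (Sec52Defs.tensorFn U.V D.f D.φ)) (Z : D.Zc 2 1)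
    (hZ : D.IsDoublingDivisor D.φ Z)
    (ρ : rsOrbitsBar U → Sec52Defs.RelPair U.Vbar.rationalPoints), (∀ O, ρ O ∈ O.1) →
    (∀ O : rsOrbitsBar U, (∀ 𝔮 ∈ inertSet E U.𝔭 \ {U.𝔭}, D.RFL 𝔮 (ρ O).1 (ρ O).2) ∧ D.AFL (ρ O).1 (ρ O).2) →
    ∀ (m : rsOrbitsBar U → symmSpace (n := U.Vbar.n) (conj F E : E →+* E) × MnPts F U.Vbar.n),
      (∀ O, IsGLRegularSemisimple ((m O).1 : Matrix (Fin U.Vbar.n) (Fin U.Vbar.n) E) (m O).2 ∧ Matches U (m O) (ρ O)) →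
      ∀ T : E, D.IKp Z hZ hrs T =
        -∑ᶠ (O : rsOrbitsBar U) (_ : Sec52Defs.formCoord U.Vbar (ρ O).2 (ρ O).2 = T),
          D.Orb (ρ O).1 (ρ O).2 *
            deriv (fun s : ℂ => ∏ᶠ (𝔮 : HeightOneSpectrum (𝓞 F)) (_ : 𝔮 ∈ inertSet E U.𝔭),
              D.omegaAt 𝔮 (m O) * D.OrbGL 𝔮 s (m O)) 0

end Sec53Data

end Sec53

end Literature.NumberTheory.Automorphic.Liu2021.Sec53OrbitalDecomposition

end
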